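import Summits.ValiantsHypothesis.ValiantsHypothesis.Theorems.GrenetZeonDualUnipotentThreeHalvesLongMassRankOne

/-!
# `GrenetZeon.DualUnipotentThreeHalves` (stmt-ValiantsHypothesis-24318), MASS-CUT line `slow_core`, stub `stub_longMassSlowLawInv`
# ((c) `SlowCore.LongMassSlowLawInv`): RANK-`r` DIRECTIONS HAVE WINDOW DEGREE ≤ `r`

The rank-one row ✓ `LongMassRankOne.totalDegree_pow_map_lineSubst_le_one_of_rankOne` (p814665) generalised to arbitrary rank:
for a nilpotent affine pencil `N` (`N ^ H = 0`) and a direction `v` whose linear coefficient matrix `(linEntry N i j v)_{ij}` factors as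
`U · W` through `Fin r` (i.e. has rank `≤ r`), EVERY power of the pull-back `N(x + s v)` has entries of `s`-degree `≤ r`.  Hence a
direction space all of whose members have coefficient-rank `≤ r` is a whole-pencil ledger of window ORDER `r`, price
`n·r + codim K` (`ledger_of_factor`, `relCert_of_factor`); e.g. the directions moving only `r` fixed COLUMNS (`ledger_of_cols`).

MATHEMATICS (adjugate minors, no transfer matrix).  Put `P = A + s·U W` over `S = ℂ[s]` (`A = N(x)`), nilpotent: `P ^ H = 0`.
* §1 A determinant `det(fromBlocks A' B' C' D')` whose LEFT block-column has `s`-free entries and whose RIGHT block-column (`r` columns)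
  has entries of `s`-degree `≤ 1` has `s`-degree `≤ r` (Leibniz: every product takes exactly `r` entries from the right columns); by the
  Schur complement `det(G + s·E F) = det(fromBlocks G (−s E) F 1)` (`Matrix.det_fromBlocks_one₂₂`), so `det(G + s·E·F)` has `s`-degree
  `≤ r` whenever `E` has `r` columns.
* §2 Every entry of `adj(1 − P)` is such a determinant (`Matrix.adjugate_apply`: replace row `j` of `1 − A − s U W` by `e_i`; the
  perturbation is still `s · (U with row j zeroed) · W`), so `deg_s adj(1 − P)_{ij} ≤ r`.  Nilpotency gives `(1 − P)·Σ_{a<H} P^a = 1`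
  (`mul_neg_geom_sum`), so `det(1 − P)` is a unit of `ℂ[s]`, i.e. a nonzero constant (`MvPolynomial.isUnit_iff_eq_C_of_isReduced`), and
  `adj(1 − P) = det(1 − P) • Σ_{a<H} P^a`; hence `deg_s (Σ_{a<H} P^a)_{ij} ≤ r`.
* §3 Applying §2 to the rescaled pencils `t·P` (`t ∈ ℂ`) bounds `deg_s Σ_{a<H} t^a (P^a)_{ij} ≤ r` for every `t`; a Vandermonde
  inversion at the nodes `t = 0, 1, …, H−1` (`Matrix.det_vandermonde_ne_zero_iff`) extracts each `(P^a)_{ij}`: `deg_s (P^a)_{ij} ≤ r`.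
* §4 Pencil form, ledger form, price, column form.

USE (enemy spec of (c), crit-7 V34 §2; g0's census row p814772 `count_criterion_needs_rankTwo` sharpened from rank 2 to rank `r`): along
a direction of coefficient-rank `r` the window order is at most `r`, so a whole-pencil certificate of price `n·r + codim K` exists for
every direction space `K` of rank-`≤ r` members; a (c)-violator of size `b` (price bound `c·√n·b`) must therefore be COORDINATE-FAT:
outside every subspace of codimension `≤ c√n·b − n·r` some direction has coefficient-rank `> r`, for every `r < c·b/√n`.
Honest framing: a support lemma (`--supports stmt-ValiantsHypothesis-24318`); NOT progress on (c) `LongMassSlowLawInv` itself, which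
with S3 `SlowPlane`, the crux 24318, the rung 8062 and `VP ≠ VNP` stays OPEN / NOT proved.  No sorry, no definitions, no named facts.
[folklore: rank-`r` perturbations move a determinant to degree `≤ r`; adjugate of a unipotent matrix; Vandermonde interpolation]
-/

-- single-conjunct layout: Sub = Summit, duplicated namespace component intended (the name is mandated)
set_option linter.dupNamespace false
set_option autoImplicit false

noncomputable section

namespace Summit.ValiantsHypothesis.ValiantsHypothesis.Theorems.GrenetZeon.LongMassRankR

open MvPolynomial Matrix
open scoped BigOperators
open Summit.ValiantsHypothesis.ValiantsHypothesis.Cruxes.TwoDimCoefficients.DimTwoCases (AffMat IsAffine)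
open Summit.ValiantsHypothesis.ValiantsHypothesis.Theorems.GrenetZeon.RadicalSplit (lineSubst)
open Summit.ValiantsHypothesis.ValiantsHypothesis.Theorems.GrenetZeon.SlowCore (Ledger RelCert linEntry lineSubst_apply_of_le_one)
open Summit.ValiantsHypothesis.ValiantsHypothesis.Theorems.GrenetZeon.Ceilings (pow_lineSubst_eq_zero)

-- The one-variable polynomial ring `ℂ[s]` of the pull-backs is `MvPolynomial (Fin 1) ℂ` (`s = X 0`), as in ✓ `…LongMassRankOne`.

/-! ## §1 Degree of a determinant perturbed in `r` columns -/

section Degree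

variable {k r : ℕ}

/-- An integer cast into `ℂ[s]` is a constant. -/
theorem totalDegree_intCast (z : ℤ) : ((z : (MvPolynomial (Fin 1) ℂ))).totalDegree = 0 := by
  rw [← map_intCast (C : ℂ →+* (MvPolynomial (Fin 1) ℂ)) z, totalDegree_C]

/-- **Leibniz count.**  A block determinant whose left block-column is `s`-free and whose right block-column (`r` columns) has
entries of `s`-degree `≤ 1` has `s`-degree `≤ r`. [folklore] -/
theorem totalDegree_det_fromBlocks_le (A : Matrix (Fin k) (Fin k) (MvPolynomial (Fin 1) ℂ)) (B : Matrix (Fin k) (Fin r) (MvPolynomial (Fin 1) ℂ))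
    (C' : Matrix (Fin r) (Fin k) (MvPolynomial (Fin 1) ℂ)) (D : Matrix (Fin r) (Fin r) (MvPolynomial (Fin 1) ℂ))
    (hA : ∀ i j, (A i j).totalDegree = 0) (hC : ∀ i j, (C' i j).totalDegree = 0)
    (hB : ∀ i j, (B i j).totalDegree ≤ 1) (hD : ∀ i j, (D i j).totalDegree ≤ 1) :
    (Matrix.fromBlocks A B C' D).det.totalDegree ≤ r := by
  rw [Matrix.det_apply']
  refine (totalDegree_finsetSum _ _).trans (Finset.sup_le fun σ _ => ?_)
  refine (totalDegree_mul _ _).trans ?_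
  rw [totalDegree_intCast, zero_add]
  refine (totalDegree_finsetProd _ _).trans ?_
  rw [Fintype.sum_sum_type]
  have h1 : ∑ a : Fin k, ((Matrix.fromBlocks A B C' D) (σ (Sum.inl a)) (Sum.inl a)).totalDegree = 0 := by
    refine Finset.sum_eq_zero fun a _ => ?_
    rcases hσ : σ (Sum.inl a) with i | i
    · rw [Matrix.fromBlocks_apply₁₁]; exact hA i a
    · rw [Matrix.fromBlocks_apply₂₁]; exact hC i a
  have h2 : ∑ b : Fin r, ((Matrix.fromBlocks A B C' D) (σ (Sum.inr b)) (Sum.inr b)).totalDegree ≤ ∑ _b : Fin r, 1 := by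
    refine Finset.sum_le_sum fun b _ => ?_
    rcases hσ : σ (Sum.inr b) with i | i
    · rw [Matrix.fromBlocks_apply₁₂]; exact hB i b
    · rw [Matrix.fromBlocks_apply₂₂]; exact hD i b
  rw [h1, zero_add]
  refine h2.trans ?_
  rw [Finset.sum_const, Finset.card_univ, Fintype.card_fin, smul_eq_mul, mul_one]

/-- **A rank-`r` perturbation moves a determinant to `s`-degree `≤ r`**: `deg_s det(G + s·E·F) ≤ r` for complex `G` (`k × k`),
`E` (`k × r`), `F` (`r × k`) — Schur complement `det(G + s E F) = det(fromBlocks G (−s E) F 1)` and the Leibniz count. [folklore] -/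
theorem totalDegree_det_add_smul_mul_le (G : Matrix (Fin k) (Fin k) ℂ) (E : Matrix (Fin k) (Fin r) ℂ)
    (F : Matrix (Fin r) (Fin k) ℂ) :
    (G.map (C : ℂ → (MvPolynomial (Fin 1) ℂ)) + (X 0 : (MvPolynomial (Fin 1) ℂ)) • (E * F).map (C : ℂ → (MvPolynomial (Fin 1) ℂ))).det.totalDegree ≤ r := by
  have h : G.map (C : ℂ → (MvPolynomial (Fin 1) ℂ)) + (X 0 : (MvPolynomial (Fin 1) ℂ)) • (E * F).map (C : ℂ → (MvPolynomial (Fin 1) ℂ)) =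
      G.map (C : ℂ → (MvPolynomial (Fin 1) ℂ)) - (-((X 0 : (MvPolynomial (Fin 1) ℂ)) • E.map (C : ℂ → (MvPolynomial (Fin 1) ℂ)))) * F.map (C : ℂ → (MvPolynomial (Fin 1) ℂ)) := by
    rw [Matrix.neg_mul, sub_neg_eq_add, Matrix.smul_mul, ← Matrix.map_mul]
  rw [h, ← Matrix.det_fromBlocks_one₂₂]
  refine totalDegree_det_fromBlocks_le _ _ _ _ (fun i j => ?_) (fun i j => ?_) (fun i j => ?_) (fun i j => ?_)
  · rw [Matrix.map_apply, totalDegree_C]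
  · rw [Matrix.map_apply, totalDegree_C]
  · rw [Matrix.neg_apply, totalDegree_neg, Matrix.smul_apply, Matrix.map_apply, smul_eq_mul]
    refine (totalDegree_mul _ _).trans ?_
    rw [totalDegree_X, totalDegree_C]
  · rw [Matrix.one_apply]
    split_ifs
    · rw [totalDegree_one]; exact Nat.zero_le _
    · rw [totalDegree_zero]; exact Nat.zero_le _

end Degree

/-! ## §2 The adjugate of `1 − P` for the pencil `P = A + s·U·W` -/

section Adjugate

variable {m r : ℕ}

/-- Replacing a row of the pencil `A + s·Y` by a basis vector replaces the rows of `A` and zeroes the row of `Y`. -/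
theorem updateRow_pencil (A Y : Matrix (Fin m) (Fin m) ℂ) (i j : Fin m) :
    (A.map (C : ℂ → (MvPolynomial (Fin 1) ℂ)) + (X 0 : (MvPolynomial (Fin 1) ℂ)) • Y.map (C : ℂ → (MvPolynomial (Fin 1) ℂ))).updateRow j (Pi.single i 1) =
      (A.updateRow j (Pi.single i 1)).map (C : ℂ → (MvPolynomial (Fin 1) ℂ)) + (X 0 : (MvPolynomial (Fin 1) ℂ)) • (Y.updateRow j 0).map (C : ℂ → (MvPolynomial (Fin 1) ℂ)) := by
  refine Matrix.ext fun a b => ?_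
  by_cases h : a = j
  · subst h
    simp only [Matrix.updateRow_self, Matrix.add_apply, Matrix.smul_apply, Matrix.map_apply, Pi.single_apply,
      Pi.zero_apply, smul_eq_mul, map_zero, mul_zero, add_zero]
    split_ifs
    · exact (map_one _).symm
    · exact (map_zero _).symm
  · simp only [Matrix.updateRow_ne h, Matrix.add_apply, Matrix.smul_apply, Matrix.map_apply]

/-- Zeroing a row commutes with right multiplication. -/
theorem updateRow_zero_mul (U : Matrix (Fin m) (Fin r) ℂ) (W : Matrix (Fin r) (Fin m) ℂ) (j : Fin m) :
    U.updateRow j 0 * W = (U * W).updateRow j 0 := by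
  refine Matrix.ext fun a b => ?_
  by_cases h : a = j
  · subst h
    simp [Matrix.mul_apply, Matrix.updateRow_self]
  · simp [Matrix.mul_apply, Matrix.updateRow_ne h]

/-- **Adjugate entries of `1 − (A + s·U·W)` have `s`-degree `≤ r`** (`U` with `r` columns): each is the determinant of
`1 − A − s U W` with one row replaced by a basis vector, a rank-`r` perturbation of a complex matrix. [this file] -/
theorem totalDegree_adjugate_one_sub_le (A : Matrix (Fin m) (Fin m) ℂ) (U : Matrix (Fin m) (Fin r) ℂ)
    (W : Matrix (Fin r) (Fin m) ℂ) (i j : Fin m) :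
    ((1 - (A.map (C : ℂ → (MvPolynomial (Fin 1) ℂ)) + (X 0 : (MvPolynomial (Fin 1) ℂ)) • (U * W).map (C : ℂ → (MvPolynomial (Fin 1) ℂ)))).adjugate i j).totalDegree ≤ r := by
  have h1 : (1 : Matrix (Fin m) (Fin m) (MvPolynomial (Fin 1) ℂ)) - (A.map (C : ℂ → (MvPolynomial (Fin 1) ℂ)) + (X 0 : (MvPolynomial (Fin 1) ℂ)) • (U * W).map (C : ℂ → (MvPolynomial (Fin 1) ℂ))) =
      (1 - A).map (C : ℂ → (MvPolynomial (Fin 1) ℂ)) + (X 0 : (MvPolynomial (Fin 1) ℂ)) • ((-U) * W).map (C : ℂ → (MvPolynomial (Fin 1) ℂ)) := by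
    rw [Matrix.neg_mul]
    refine Matrix.ext fun a b => ?_
    simp only [Matrix.sub_apply, Matrix.add_apply, Matrix.one_apply, Matrix.map_apply, Matrix.smul_apply,
      Matrix.neg_apply, smul_eq_mul, map_sub, map_neg, apply_ite (C : ℂ → (MvPolynomial (Fin 1) ℂ)), map_one, map_zero]
    ring
  rw [h1, Matrix.adjugate_apply, updateRow_pencil, ← updateRow_zero_mul]
  exact totalDegree_det_add_smul_mul_le _ _ _

/-- **The geometric sum `Σ_{a<H} P^a` of a NILPOTENT pencil `P = A + s·U·W` has entries of `s`-degree `≤ r`.**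
Nilpotency gives `(1 − P)·Σ_{a<H} P^a = 1`, so `det(1 − P)` is a unit of `ℂ[s]` (a nonzero constant) and
`adj(1 − P) = det(1 − P) • Σ_{a<H} P^a`. [this file] -/
theorem totalDegree_geom_sum_apply_le (A : Matrix (Fin m) (Fin m) ℂ) (U : Matrix (Fin m) (Fin r) ℂ)
    (W : Matrix (Fin r) (Fin m) ℂ) {H : ℕ} (hP : (A.map (C : ℂ → (MvPolynomial (Fin 1) ℂ)) + (X 0 : (MvPolynomial (Fin 1) ℂ)) • (U * W).map (C : ℂ → (MvPolynomial (Fin 1) ℂ))) ^ H = 0)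
    (i j : Fin m) :
    ((∑ a ∈ Finset.range H, (A.map (C : ℂ → (MvPolynomial (Fin 1) ℂ)) + (X 0 : (MvPolynomial (Fin 1) ℂ)) • (U * W).map (C : ℂ → (MvPolynomial (Fin 1) ℂ))) ^ a) i j).totalDegree ≤ r := by
  set P : Matrix (Fin m) (Fin m) (MvPolynomial (Fin 1) ℂ) := A.map (C : ℂ → (MvPolynomial (Fin 1) ℂ)) + (X 0 : (MvPolynomial (Fin 1) ℂ)) • (U * W).map (C : ℂ → (MvPolynomial (Fin 1) ℂ)) with hPdef
  set B : Matrix (Fin m) (Fin m) (MvPolynomial (Fin 1) ℂ) := ∑ a ∈ Finset.range H, P ^ a with hB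
  have hinv : (1 - P) * B = 1 := by rw [hB, mul_neg_geom_sum, hP, sub_zero]
  have hdet : IsUnit (1 - P).det := by
    have h := congrArg Matrix.det hinv
    rw [Matrix.det_mul, Matrix.det_one] at h
    exact IsUnit.of_mul_eq_one _ h
  obtain ⟨c, hc, hcdet⟩ := (MvPolynomial.isUnit_iff_eq_C_of_isReduced).mp hdet
  have hadj : (1 - P).adjugate = (1 - P).det • B := by
    calc (1 - P).adjugate = (1 - P).adjugate * ((1 - P) * B) := by rw [hinv, Matrix.mul_one]
      _ = (1 - P).det • B := by rw [← Matrix.mul_assoc, Matrix.adjugate_mul, Matrix.smul_mul, Matrix.one_mul]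
  have hentry : B i j = C c⁻¹ * (1 - P).adjugate i j := by
    rw [hadj, Matrix.smul_apply, smul_eq_mul, hcdet, ← mul_assoc, ← map_mul, inv_mul_cancel₀ hc.ne_zero, map_one,
      one_mul]
  rw [hentry]
  refine (totalDegree_mul _ _).trans ?_
  rw [totalDegree_C, zero_add, hPdef]
  exact totalDegree_adjugate_one_sub_le A U W i j

end Adjugate

/-! ## §3 Vandermonde extraction and the matrix-level theorem -/

section Extraction

variable {m r : ℕ}

/-- **Vandermonde extraction.**  If every weighted sum `Σ_a t^a·g_a` (`t ∈ ℂ`) has `s`-degree `≤ r`, so has every `g_a`: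
invert the Vandermonde matrix at the nodes `0, 1, …, H−1`. [folklore] -/
theorem totalDegree_le_of_forall_sum_pow_smul {H : ℕ} (g : Fin H → (MvPolynomial (Fin 1) ℂ))
    (h : ∀ t : ℂ, (∑ a : Fin H, t ^ (a : ℕ) • g a).totalDegree ≤ r) (a : Fin H) : (g a).totalDegree ≤ r := by
  set v : Fin H → ℂ := fun b => ((b : ℕ) : ℂ) with hv
  have hvinj : Function.Injective v := by
    intro b₁ b₂ hb
    exact Fin.ext (Nat.cast_injective (R := ℂ) hb)
  set V : Matrix (Fin H) (Fin H) ℂ := Matrix.vandermonde v with hV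
  have hdet : IsUnit V.det := isUnit_iff_ne_zero.mpr (Matrix.det_vandermonde_ne_zero_iff.mpr hvinj)
  set Cm : Matrix (Fin H) (Fin H) ℂ →+* Matrix (Fin H) (Fin H) (MvPolynomial (Fin 1) ℂ) := (C : ℂ →+* (MvPolynomial (Fin 1) ℂ)).mapMatrix with hCm
  have hVV : Cm V⁻¹ * Cm V = 1 := by rw [← map_mul, Matrix.nonsing_inv_mul V hdet, map_one]
  have hF : ∀ b, ((Cm V) *ᵥ g) b = ∑ a : Fin H, v b ^ (a : ℕ) • g a := by
    intro b
    rw [Matrix.mulVec, dotProduct]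
    refine Finset.sum_congr rfl fun a _ => ?_
    rw [hCm, RingHom.mapMatrix_apply, Matrix.map_apply, hV, Matrix.vandermonde_apply, ← C_mul', map_pow]
  have hg : g = Cm V⁻¹ *ᵥ (Cm V *ᵥ g) := by rw [Matrix.mulVec_mulVec, hVV, Matrix.one_mulVec]
  have hga : g a = ∑ b, Cm V⁻¹ a b * (Cm V *ᵥ g) b := by
    conv_lhs => rw [hg]
    rw [Matrix.mulVec, dotProduct]
  rw [hga]
  refine (totalDegree_finsetSum _ _).trans (Finset.sup_le fun b _ => ?_)
  refine (totalDegree_mul _ _).trans ?_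
  rw [hCm, RingHom.mapMatrix_apply, Matrix.map_apply, totalDegree_C, zero_add, hF]
  exact h (v b)

/-- ★ **MATRIX FORM.**  For a nilpotent pencil `P = A + s·U·W` over `ℂ[s]` (`P ^ H = 0`; `U` with `r` columns), EVERY power `P^p`
has entries of `s`-degree `≤ r`. [this file] -/
theorem totalDegree_pow_apply_le (A : Matrix (Fin m) (Fin m) ℂ) (U : Matrix (Fin m) (Fin r) ℂ)
    (W : Matrix (Fin r) (Fin m) ℂ) {H : ℕ} (hP : (A.map (C : ℂ → (MvPolynomial (Fin 1) ℂ)) + (X 0 : (MvPolynomial (Fin 1) ℂ)) • (U * W).map (C : ℂ → (MvPolynomial (Fin 1) ℂ))) ^ H = 0)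
    (p : ℕ) (i j : Fin m) :
    ((((A.map (C : ℂ → (MvPolynomial (Fin 1) ℂ)) + (X 0 : (MvPolynomial (Fin 1) ℂ)) • (U * W).map (C : ℂ → (MvPolynomial (Fin 1) ℂ))) ^ p) i j)).totalDegree ≤ r := by
  set P : Matrix (Fin m) (Fin m) (MvPolynomial (Fin 1) ℂ) := A.map (C : ℂ → (MvPolynomial (Fin 1) ℂ)) + (X 0 : (MvPolynomial (Fin 1) ℂ)) • (U * W).map (C : ℂ → (MvPolynomial (Fin 1) ℂ)) with hPdef
  by_cases hp : H ≤ p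
  · rw [show p = H + (p - H) by omega, pow_add, hP, Matrix.zero_mul, Matrix.zero_apply, totalDegree_zero]
    exact Nat.zero_le _
  push Not at hp
  -- the rescaled pencils `t·P`
  have hscale : ∀ t : ℂ, (C t : (MvPolynomial (Fin 1) ℂ)) • P =
      (t • A).map (C : ℂ → (MvPolynomial (Fin 1) ℂ)) + (X 0 : (MvPolynomial (Fin 1) ℂ)) • ((t • U) * W).map (C : ℂ → (MvPolynomial (Fin 1) ℂ)) := by
    intro t
    rw [Matrix.smul_mul]
    refine Matrix.ext fun a b => ?_
    simp only [hPdef, Matrix.smul_apply, Matrix.add_apply, Matrix.map_apply, smul_eq_mul, map_mul]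
    ring
  have hscaleH : ∀ t : ℂ, ((t • A).map (C : ℂ → (MvPolynomial (Fin 1) ℂ)) + (X 0 : (MvPolynomial (Fin 1) ℂ)) • ((t • U) * W).map (C : ℂ → (MvPolynomial (Fin 1) ℂ))) ^ H = 0 := by
    intro t
    rw [← hscale, smul_pow, hP, smul_zero]
  set g : Fin H → (MvPolynomial (Fin 1) ℂ) := fun a => (P ^ (a : ℕ)) i j with hg
  have key : ∀ t : ℂ, (∑ a : Fin H, t ^ (a : ℕ) • g a).totalDegree ≤ r := by
    intro t
    have h1 := totalDegree_geom_sum_apply_le (t • A) (t • U) W (hscaleH t) i j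
    rw [← hscale t, Matrix.sum_apply] at h1
    have h2 : (∑ a : Fin H, t ^ (a : ℕ) • g a) = ∑ a ∈ Finset.range H, (((C t : (MvPolynomial (Fin 1) ℂ)) • P) ^ a) i j := by
      rw [← Fin.sum_univ_eq_sum_range (fun a => (((C t : (MvPolynomial (Fin 1) ℂ)) • P) ^ a) i j) H]
      refine Finset.sum_congr rfl fun a _ => ?_
      rw [hg, smul_pow, Matrix.smul_apply, smul_eq_mul, ← map_pow, C_mul']
    rw [h2]
    exact h1
  exact totalDegree_le_of_forall_sum_pow_smul g key ⟨p, hp⟩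

end Extraction

/-! ## §4 ★ Rank-`r` directions have window degree `≤ r` -/

variable {n m r : ℕ}

/-- The pull-back of an affine pencil along `x + s·v` is `N(x) + s·lin_v N`, written with a factorisation `U·W` of the linear part. -/
theorem map_lineSubst_eq_of_factor (N : AffMat n m) (hN : IsAffine N) (x v : Fin n × Fin n → ℂ)
    (U : Matrix (Fin m) (Fin r) ℂ) (W : Matrix (Fin r) (Fin m) ℂ) (hv : ∀ i j, linEntry N i j v = (U * W) i j) :
    N.map (lineSubst x v) =
      (N.map (eval x)).map (C : ℂ → (MvPolynomial (Fin 1) ℂ)) + (X 0 : (MvPolynomial (Fin 1) ℂ)) • (U * W).map (C : ℂ → (MvPolynomial (Fin 1) ℂ)) := by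
  ext i j
  rw [Matrix.map_apply, lineSubst_apply_of_le_one N hN x v i j, Matrix.add_apply, Matrix.map_apply, Matrix.map_apply,
    Matrix.smul_apply, Matrix.map_apply, hv i j, smul_eq_mul, mul_comm (X 0)]

/-- ★ **RANK-`r` DIRECTIONS HAVE WINDOW DEGREE ≤ `r`.**  For an affine pencil `N` with `N ^ H = 0` and a direction `v` whose linear
coefficient matrix factors as `U·W` through `Fin r` (rank `≤ r`), EVERY power of the pull-back `N(x + s v)` has entries of `s`-degree
`≤ r`. (`r = 1`: ✓ `LongMassRankOne.totalDegree_pow_map_lineSubst_le_one_of_rankOne`.) [this file] -/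
theorem totalDegree_pow_map_lineSubst_le_of_factor (N : AffMat n m) (hN : IsAffine N) {H : ℕ} (hnil : N ^ H = 0)
    (x v : Fin n × Fin n → ℂ) (U : Matrix (Fin m) (Fin r) ℂ) (W : Matrix (Fin r) (Fin m) ℂ)
    (hv : ∀ i j, linEntry N i j v = (U * W) i j) (p : ℕ) (i j : Fin m) :
    ((((N.map (lineSubst x v)) ^ p) i j)).totalDegree ≤ r := by
  have hlin : (N.map (lineSubst x v)) ^ H = 0 :=
    pow_lineSubst_eq_zero N (fun y => by rw [← Matrix.map_pow, hnil]; exact Matrix.map_zero _ (map_zero _)) x v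
  rw [map_lineSubst_eq_of_factor N hN x v U W hv] at hlin ⊢
  exact totalDegree_pow_apply_le _ U W hlin p i j

/-- ★ **LEDGER FORM.**  A direction space ALL of whose members have linear coefficient matrix of rank `≤ r` (a factorisation through
`Fin r`) is a whole-pencil ledger of window order `r`, for every nilpotent affine pencil. [this file] -/
theorem ledger_of_factor (N : AffMat n m) (hN : IsAffine N) {H : ℕ} (hnil : N ^ H = 0)
    (K : Submodule ℂ (Fin n × Fin n → ℂ))
    (hK : ∀ v ∈ K, ∃ (U : Matrix (Fin m) (Fin r) ℂ) (W : Matrix (Fin r) (Fin m) ℂ), ∀ i j, linEntry N i j v = (U * W) i j) :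
    Ledger n m N (fun _ => True) K r := by
  intro x v hv b _ i j _ _
  obtain ⟨U, W, hUW⟩ := hK v hv
  exact totalDegree_pow_map_lineSubst_le_of_factor N hN hnil x v U W hUW b i j

/-- ★ **PRICE.**  Such a direction space certifies the whole pencil at price `n·r + codim K`. [this file] -/
theorem relCert_of_factor (N : AffMat n m) (hN : IsAffine N) {H : ℕ} (hnil : N ^ H = 0)
    (K : Submodule ℂ (Fin n × Fin n → ℂ))
    (hK : ∀ v ∈ K, ∃ (U : Matrix (Fin m) (Fin r) ℂ) (W : Matrix (Fin r) (Fin m) ℂ), ∀ i j, linEntry N i j v = (U * W) i j) :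
    RelCert n m N (n * r + (n * n - Module.finrank ℂ K)) :=
  ⟨K, r, ledger_of_factor N hN hnil K hK, le_rfl⟩

/-- ★ **COLUMN FORM.**  The directions that move only the `r` columns `c 0, …, c (r−1)` of the pencil (`c` injective) form a
whole-pencil ledger of window order `r`: their coefficient matrices factor through the column selection. [this file] -/
theorem ledger_of_cols (N : AffMat n m) (hN : IsAffine N) {H : ℕ} (hnil : N ^ H = 0) (c : Fin r → Fin m)
    (hc : Function.Injective c) (K : Submodule ℂ (Fin n × Fin n → ℂ))
    (hK : ∀ v ∈ K, ∀ i j, (∀ l, j ≠ c l) → linEntry N i j v = 0) :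
    Ledger n m N (fun _ => True) K r := by
  classical
  refine ledger_of_factor N hN hnil K fun v hv => ?_
  refine ⟨Matrix.of fun i l => linEntry N i (c l) v, Matrix.of fun l j => if j = c l then (1 : ℂ) else 0, fun i j => ?_⟩
  rw [Matrix.mul_apply]
  by_cases hj : ∃ l, j = c l
  · obtain ⟨l₀, rfl⟩ := hj
    rw [Finset.sum_eq_single l₀]
    · simp
    · intro l _ hl
      rw [Matrix.of_apply, Matrix.of_apply, if_neg (fun h => hl (hc h.symm)), mul_zero]
    · intro h; exact absurd (Finset.mem_univ l₀) h
  · push Not at hj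
    rw [hK v hv i j hj]
    refine (Finset.sum_eq_zero fun l _ => ?_).symm
    rw [Matrix.of_apply, Matrix.of_apply, if_neg (hj l), mul_zero]

/-- ★ **ROW FORM.**  The directions that move only the `r` rows `ρ 0, …, ρ (r−1)` of the pencil (`ρ` injective) form a whole-pencil
ledger of window order `r`. [this file] -/
theorem ledger_of_rows (N : AffMat n m) (hN : IsAffine N) {H : ℕ} (hnil : N ^ H = 0) (ρ : Fin r → Fin m)
    (hρ : Function.Injective ρ) (K : Submodule ℂ (Fin n × Fin n → ℂ))
    (hK : ∀ v ∈ K, ∀ i j, (∀ l, i ≠ ρ l) → linEntry N i j v = 0) :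
    Ledger n m N (fun _ => True) K r := by
  classical
  refine ledger_of_factor N hN hnil K fun v hv => ?_
  refine ⟨Matrix.of fun i l => if i = ρ l then (1 : ℂ) else 0, Matrix.of fun l j => linEntry N (ρ l) j v, fun i j => ?_⟩
  rw [Matrix.mul_apply]
  by_cases hi : ∃ l, i = ρ l
  · obtain ⟨l₀, rfl⟩ := hi
    rw [Finset.sum_eq_single l₀]
    · simp
    · intro l _ hl
      rw [Matrix.of_apply, Matrix.of_apply, if_neg (fun h => hl (hρ h.symm)), zero_mul]
    · intro h; exact absurd (Finset.mem_univ l₀) h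
  · push Not at hi
    rw [hK v hv i j hi]
    refine (Finset.sum_eq_zero fun l _ => ?_).symm
    rw [Matrix.of_apply, Matrix.of_apply, if_neg (hi l), zero_mul]

/-! ## §5 Rank form: coefficient-rank `≤ r` ⇒ window order `≤ r` -/

/-- **Rank factorisation** of a square complex matrix through `Fin (rank M)`: `M = U · W`.
[folklore; from `Matrix.exists_rank_normal_form`] -/
theorem exists_factor_of_rank (M : Matrix (Fin m) (Fin m) ℂ) :
    ∃ (U : Matrix (Fin m) (Fin M.rank) ℂ) (W : Matrix (Fin M.rank) (Fin m) ℂ), M = U * W := by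
  obtain ⟨V, T, e, hV, hT, hVMT⟩ := Matrix.exists_rank_normal_form M
  have hVd : IsUnit V.det := (Matrix.isUnit_iff_isUnit_det V).mp hV
  have hTd : IsUnit T.det := (Matrix.isUnit_iff_isUnit_det T).mp hT
  have hM : M = V⁻¹ * (V * M * T) * T⁻¹ := by
    rw [Matrix.mul_assoc V, Matrix.nonsing_inv_mul_cancel_left V (M * T) hVd, Matrix.mul_nonsing_inv_cancel_right T M hTd]
  have hfac : (Matrix.fromBlocks 1 0 0 0 :
      Matrix (Fin M.rank ⊕ Fin (Fintype.card (Fin m) - M.rank)) (Fin M.rank ⊕ Fin (Fintype.card (Fin m) - M.rank)) ℂ) =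
      Matrix.fromRows (1 : Matrix (Fin M.rank) (Fin M.rank) ℂ) (0 : Matrix (Fin (Fintype.card (Fin m) - M.rank)) (Fin M.rank) ℂ) *
        Matrix.fromCols (1 : Matrix (Fin M.rank) (Fin M.rank) ℂ) (0 : Matrix (Fin M.rank) (Fin (Fintype.card (Fin m) - M.rank)) ℂ) := by
    rw [Matrix.fromRows_mul_fromCols, Matrix.one_mul, Matrix.one_mul, Matrix.zero_mul, Matrix.zero_mul]
  refine ⟨V⁻¹ * (Matrix.fromRows (1 : Matrix (Fin M.rank) (Fin M.rank) ℂ)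
      (0 : Matrix (Fin (Fintype.card (Fin m) - M.rank)) (Fin M.rank) ℂ)).submatrix e _root_.id,
    (Matrix.fromCols (1 : Matrix (Fin M.rank) (Fin M.rank) ℂ)
      (0 : Matrix (Fin M.rank) (Fin (Fintype.card (Fin m) - M.rank)) ℂ)).submatrix _root_.id e * T⁻¹, ?_⟩
  calc M = V⁻¹ * (V * M * T) * T⁻¹ := hM
    _ = V⁻¹ * ((Matrix.fromRows (1 : Matrix (Fin M.rank) (Fin M.rank) ℂ)
          (0 : Matrix (Fin (Fintype.card (Fin m) - M.rank)) (Fin M.rank) ℂ) *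
          Matrix.fromCols (1 : Matrix (Fin M.rank) (Fin M.rank) ℂ)
          (0 : Matrix (Fin M.rank) (Fin (Fintype.card (Fin m) - M.rank)) ℂ)).submatrix e e) * T⁻¹ := by
        rw [hVMT, hfac]
    _ = _ := by
        rw [Matrix.submatrix_mul _ _ e _root_.id e Function.bijective_id]
        simp only [Matrix.mul_assoc]

/-- ★ **RANK FORM.**  A direction space all of whose members have linear coefficient matrix of RANK `≤ r` is a whole-pencil ledger of
window order `r`, for every nilpotent affine pencil. [this file] -/
theorem ledger_of_rank (N : AffMat n m) (hN : IsAffine N) {H : ℕ} (hnil : N ^ H = 0)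
    (K : Submodule ℂ (Fin n × Fin n → ℂ)) (hK : ∀ v ∈ K, (Matrix.of fun i j => linEntry N i j v).rank ≤ r) :
    Ledger n m N (fun _ => True) K r := by
  intro x v hv b _ i j _ _
  obtain ⟨U, W, hUW⟩ := exists_factor_of_rank (Matrix.of fun i j => linEntry N i j v)
  have h := totalDegree_pow_map_lineSubst_le_of_factor N hN hnil x v U W
    (fun i' j' => by rw [← hUW, Matrix.of_apply]) b i j
  exact h.trans (hK v hv)

/-- ★ **PRICE, rank form.**  Coefficient-rank `≤ r` along `K` certifies the whole pencil at price `n·r + codim K`; in particular a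
(c)-violator of size `b` admits NO direction space `K` with `n·r + codim K ≤ c·√n·b` all of whose members have coefficient-rank `≤ r`.
[this file] -/
theorem relCert_of_rank (N : AffMat n m) (hN : IsAffine N) {H : ℕ} (hnil : N ^ H = 0)
    (K : Submodule ℂ (Fin n × Fin n → ℂ)) (hK : ∀ v ∈ K, (Matrix.of fun i j => linEntry N i j v).rank ≤ r) :
    RelCert n m N (n * r + (n * n - Module.finrank ℂ K)) :=
  ⟨K, r, ledger_of_rank N hN hnil K hK, le_rfl⟩

/-- ★ **EVERY nilpotent affine `m × m` pencil is certified at price `n·m`** (`K = ⊤`, `r = m`: along every direction all powers have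
`s`-degree `≤ m`) — the trivial end of the scale, recorded for calibration: (c) asks for price `c·√n·b` on `b × b` constituents, a
factor `√n / c` below this trivial `n·b`. [this file] -/
theorem relCert_top (N : AffMat n m) (hN : IsAffine N) {H : ℕ} (hnil : N ^ H = 0) :
    RelCert n m N (n * m + (n * n - Module.finrank ℂ (⊤ : Submodule ℂ (Fin n × Fin n → ℂ)))) :=
  relCert_of_rank N hN hnil ⊤ fun _ _ => Matrix.rank_le_width _

end Summit.ValiantsHypothesis.ValiantsHypothesis.Theorems.GrenetZeon.LongMassRankR

end
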